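import Summits.QuantumFields.QCD.Theses.PauliWegnerSea
import Literature.MathematicalPhysics.QuantumFieldTheory.QCDPhaseQuenched
import Literature.MathematicalPhysics.QuantumLattice.TorusWilsonGibbs

/-!
# Stub `stub_resampling` of line `adjugate-anticoncentration-pin`
(crux `Summit.QuantumFields.QCD.Theses.PauliWegnerSea.OneScaleTrajectory`,
item stmt-QuantumFields-11513)

## What is proved

The heat-bath (DLR / resampling) identity for the finite-volume Wilson measure
`μ_W = Z⁻¹ e^{-β S_W} ∏_links dHaar` of `SU(3)` lattice gauge theory on the four-torus: for every
set of links `P` and every measurable `Φ ≥ 0`,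

  `∫ Φ dμ_W = ∫ (∫ Φ(V) e^{-β S_W(V)} dHaar(W) / ∫ e^{-β S_W(V)} dHaar(W)) dμ_W(U)`,
  `V := W_P ∨ U_{Pᶜ}`,

where `W_P ∨ U_{Pᶜ}` is the configuration `U` with its `P`-links resampled from `W` (the inner
Haar integrals run over all links; the links off `P` are not read and integrate to `1`).

## Proof

Write `μ_W = Z⁻¹ • π.withDensity w` with `π = Haar^{⊗ links}` and `w = e^{-β S_W}`; both sides
become `Z⁻¹ ∫ w · (…) dπ`, so it suffices to prove the identity for the product measure `π` with
the weight `w` inside (`pi_lintegral_mul_eq_lintegral_mul_resample`). Split the links along `P`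
with the measure-preserving equivalence `π ≃ π₁ ⊗ π₂`
(`MeasureTheory.measurePreserving_piEquivPiSubtypeProd`); the resampled configuration is
`e.symm ((e W).1, (e U).2)`, so the inner integrals are fibre integrals over `π₁` at fixed
`Pᶜ`-coordinates `(e U).2`, and by Tonelli the claim reduces to the one-line computation
`∫ (∫ w(a,b) da) · (n(b) / z(b)) db = ∫ n(b) db` with `z(b) = ∫ w(a,b) da ∈ (0, ∞)` (the Wilson
action is bounded on the compact configuration space)
(`prod_lintegral_mul_eq_lintegral_mul_fibreAverage`).

Sources: the DLR equations for finite-volume Gibbs measures, Georgii, *Gibbs Measures and Phase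
Transitions*, (1.22)–(1.24); Seiler, LNP 159, Ch. 1 (Wilson action and measure). [folklore]
-/

noncomputable section

namespace Summit.QuantumFields.QCD.Theorems.AdjugateAnticoncentrationPin

open scoped BigOperators ENNReal
open MeasureTheory Filter Set
open Literature.MathematicalPhysics.QuantumFieldTheory Literature.MathematicalPhysics.QuantumLattice
  Literature.Probability.LatticeModels

/-- **Fibre-average identity on a product.** For measurable `F, w ≥ 0` on `A × B` (s-finite
measures `μ`, `ν`) whose fibre partition functions `z(b) = ∫ w(a, b) dμ(a)` are neither `0` nor
`∞`: `∫ w F d(μ ⊗ ν) = ∫ w(q) · (∫ F(a, q₂) w(a, q₂) dμ(a) / z(q₂)) d(μ ⊗ ν)(q)` (Tonelli twice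
and `z(b) · (n(b) / z(b)) = n(b)`). [folklore] -/
private theorem prod_lintegral_mul_eq_lintegral_mul_fibreAverage {A B : Type*} [MeasurableSpace A]
    [MeasurableSpace B] (μ : Measure A) (ν : Measure B) [SFinite μ] [SFinite ν]
    {F w : A × B → ℝ≥0∞} (hF : Measurable F) (hw : Measurable w)
    (hz0 : ∀ b, ∫⁻ a, w (a, b) ∂μ ≠ 0) (hztop : ∀ b, ∫⁻ a, w (a, b) ∂μ ≠ ∞) :
    ∫⁻ q, w q * F q ∂(μ.prod ν) =
      ∫⁻ q, w q * ((∫⁻ a, F (a, q.2) * w (a, q.2) ∂μ) / ∫⁻ a, w (a, q.2) ∂μ) ∂(μ.prod ν) := by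
  have hn : Measurable fun b => ∫⁻ a, F (a, b) * w (a, b) ∂μ := (hF.mul hw).lintegral_prod_left'
  have hz : Measurable fun b => ∫⁻ a, w (a, b) ∂μ := hw.lintegral_prod_left'
  have h1 : Measurable fun q : A × B => w q * F q := hw.mul hF
  have h2 : Measurable fun q : A × B =>
      w q * ((∫⁻ a, F (a, q.2) * w (a, q.2) ∂μ) / ∫⁻ a, w (a, q.2) ∂μ) :=
    hw.mul ((hn.div hz).comp measurable_snd)
  rw [lintegral_prod_symm _ h1.aemeasurable, lintegral_prod_symm _ h2.aemeasurable]
  refine lintegral_congr fun b => ?_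
  have hwb : Measurable fun a => w (a, b) := hw.comp measurable_prodMk_right
  dsimp only
  rw [lintegral_mul_const _ hwb, ENNReal.mul_div_cancel (hz0 b) (hztop b)]
  exact lintegral_congr fun a => mul_comm _ _

/-- **Resampling identity for a weighted product measure.** On `(ι → X, ν^{⊗ι})` with a
measurable weight `w` bounded between two positive finite constants and a measurable `Φ ≥ 0`:
`∫ w Φ dπ = ∫ w(U) · (∫ Φ(r_U W) w(r_U W) dπ(W) / ∫ w(r_U W) dπ(W)) dπ(U)`, where
`r_U W = (W on p, U off p)` resamples the `p`-coordinates of `U`.  This is the DLR (heat-bath)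
equation of the tilted product measure `w · π` in the volume `p`
(Georgii, *Gibbs Measures and Phase Transitions*, (1.24)). [folklore] -/
private theorem pi_lintegral_mul_eq_lintegral_mul_resample {ι X : Type*} [Fintype ι]
    [MeasurableSpace X] (ν : Measure X) [IsProbabilityMeasure ν] (p : ι → Prop) [DecidablePred p]
    {Φ w : (ι → X) → ℝ≥0∞} (hΦ : Measurable Φ) (hw : Measurable w) {c C : ℝ≥0∞} (hc : c ≠ 0)
    (hC : C ≠ ∞) (hcw : ∀ U, c ≤ w U) (hwC : ∀ U, w U ≤ C) :
    ∫⁻ U, w U * Φ U ∂Measure.pi (fun _ => ν) =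
      ∫⁻ U, w U * ((∫⁻ W, Φ (fun i => if p i then W i else U i) *
            w (fun i => if p i then W i else U i) ∂Measure.pi (fun _ => ν)) /
          ∫⁻ W, w (fun i => if p i then W i else U i) ∂Measure.pi (fun _ => ν))
        ∂Measure.pi (fun _ => ν) := by
  set π : Measure (ι → X) := Measure.pi fun _ => ν
  set e := MeasurableEquiv.piEquivPiSubtypeProd (fun _ : ι => X) p
  set π₁ : Measure ({i // p i} → X) := Measure.pi fun _ => ν
  set π₂ : Measure ({i // ¬p i} → X) := Measure.pi fun _ => ν
  have hmp : MeasurePreserving e π (π₁.prod π₂) :=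
    measurePreserving_piEquivPiSubtypeProd (fun _ : ι => ν) p
  have hes : Measurable e.symm := e.symm.measurable
  have hmk : ∀ b : {i // ¬p i} → X, Measurable fun a : {i // p i} → X => e.symm (a, b) :=
    fun b => hes.comp measurable_prodMk_right
  -- (A) a function of the `p`-coordinates alone integrates over `π₁`
  have hA : ∀ g : ({i // p i} → X) → ℝ≥0∞, Measurable g →
      ∫⁻ W, g (e W).1 ∂π = ∫⁻ a, g a ∂π₁ := fun g hg =>
    calc ∫⁻ W, g (e W).1 ∂π = ∫⁻ q, g q.1 ∂(π₁.prod π₂) :=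
          hmp.lintegral_comp_emb e.measurableEmbedding (fun q => g q.1)
      _ = ∫⁻ a, ∫⁻ _b, g a ∂π₂ ∂π₁ := lintegral_prod _ (hg.comp measurable_fst).aemeasurable
      _ = ∫⁻ a, g a ∂π₁ := by simp only [lintegral_const, measure_univ, mul_one]
  -- (B) transport of an integral over `π` to the product `π₁ ⊗ π₂`
  have hB : ∀ g : (ι → X) → ℝ≥0∞, ∫⁻ U, g U ∂π = ∫⁻ q, g (e.symm q) ∂(π₁.prod π₂) := fun g =>
    ((hmp.symm e).lintegral_comp_emb e.symm.measurableEmbedding g).symm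
  -- the resampled configuration is `e.symm ((e W).1, (e U).2)` (definitionally), so the inner
  -- integrals are fibre integrals over `π₁` at the frozen coordinates `(e U).2`
  have hN : ∀ U, ∫⁻ W, Φ (fun i => if p i then W i else U i) *
      w (fun i => if p i then W i else U i) ∂π =
        ∫⁻ a, Φ (e.symm (a, (e U).2)) * w (e.symm (a, (e U).2)) ∂π₁ := fun U =>
    hA (fun a => Φ (e.symm (a, (e U).2)) * w (e.symm (a, (e U).2)))
      ((hΦ.comp (hmk _)).mul (hw.comp (hmk _)))
  have hD : ∀ U, ∫⁻ W, w (fun i => if p i then W i else U i) ∂π =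
      ∫⁻ a, w (e.symm (a, (e U).2)) ∂π₁ := fun U =>
    hA (fun a => w (e.symm (a, (e U).2))) (hw.comp (hmk _))
  -- the fibre partition function is neither `0` nor `∞`
  have hz0 : ∀ b, ∫⁻ a, w (e.symm (a, b)) ∂π₁ ≠ 0 := fun b => by
    refine (lt_of_lt_of_le (pos_iff_ne_zero.2 hc) ?_).ne'
    calc c = ∫⁻ _a, c ∂π₁ := by rw [lintegral_const, measure_univ, mul_one]
      _ ≤ _ := lintegral_mono fun a => hcw _
  have hztop : ∀ b, ∫⁻ a, w (e.symm (a, b)) ∂π₁ ≠ ∞ := fun b => by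
    refine ne_top_of_le_ne_top hC ?_
    calc ∫⁻ a, w (e.symm (a, b)) ∂π₁ ≤ ∫⁻ _a, C ∂π₁ := lintegral_mono fun a => hwC _
      _ = C := by rw [lintegral_const, measure_univ, mul_one]
  simp only [hN, hD]
  rw [hB (fun U => w U * Φ U), hB]
  simp only [MeasurableEquiv.apply_symm_apply]
  exact prod_lintegral_mul_eq_lintegral_mul_fibreAverage π₁ π₂ (hΦ.comp hes) (hw.comp hes)
    hz0 hztop

/-- Registered stub `stub_resampling` of line `adjugate-anticoncentration-pin` for crux
stmt-QuantumFields-11513.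

**Heat-bath (DLR) resampling identity for the Wilson measure.** For the `SU(3)` Wilson measure
`μ_W = Z⁻¹ e^{-β S_W} ∏_links dHaar` on the four-torus of side `N`, any set of links `P` and any
measurable `Φ ≥ 0`: `∫ Φ dμ_W = ∫ [tilted fibre mean of Φ at U] dμ_W(U)`, the fibre mean resampling
the `P`-links of `U` from `e^{-β S_W} Haar^{⊗P} / Z_U` (written with Haar over all links; the
unread links integrate to `1`).  This is the DLR equation of the finite-volume Gibbs measure `μ_W`
for the volume `P` (Georgii, *Gibbs Measures and Phase Transitions*, (1.24); Seiler, LNP 159,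
Ch. 1).  THE STATEMENT BELOW IS REGISTERED — DO NOT CHANGE A CHARACTER OF IT. -/
theorem stub_resampling :
    ∀ (N : ℕ) [NeZero N] (β : ℝ) (P : Edge 4 N → Prop) [DecidablePred P] (Φ : GaugeConfig 4 N SU3 → ℝ≥0∞),
      Measurable Φ →
        ∫⁻ U, Φ U ∂(wilsonMeasure (fundamentalRep (Fin 3)) β) =
          ∫⁻ U, (∫⁻ W, Φ (fun e => if P e then W e else U e) *
                ENNReal.ofReal (Real.exp (-(β * wilsonAction (fundamentalRep (Fin 3))
                  (fun e => if P e then W e else U e))))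
                ∂(Measure.pi fun _ : Edge 4 N => haarProbability SU3)) /
              (∫⁻ W, ENNReal.ofReal (Real.exp (-(β * wilsonAction (fundamentalRep (Fin 3))
                  (fun e => if P e then W e else U e))))
                ∂(Measure.pi fun _ : Edge 4 N => haarProbability SU3))
            ∂(wilsonMeasure (fundamentalRep (Fin 3)) β) := by
  intro N _ β P _ Φ hΦ
  have hρ := continuous_fundamentalRep (Fin 3)
  obtain ⟨B, hB⟩ := exists_abs_wilsonAction_le (d := 4) (L := N) (fundamentalRep (Fin 3)) hρ
  have hSm : Measurable (wilsonAction (d := 4) (L := N) (G := SU3) (fundamentalRep (Fin 3))) :=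
    measurable_wilsonAction _ hρ
  -- the Boltzmann weight `w = e^{-β S_W}` and its two-sided bounds
  have hwm : Measurable fun U : GaugeConfig 4 N SU3 =>
      ENNReal.ofReal (Real.exp (-(β * wilsonAction (fundamentalRep (Fin 3)) U))) :=
    ((hSm.const_mul β).neg.exp).ennreal_ofReal
  have hbd : ∀ U : GaugeConfig 4 N SU3, |β * wilsonAction (fundamentalRep (Fin 3)) U| ≤ |β| * B :=
    fun U => by rw [abs_mul]; exact mul_le_mul_of_nonneg_left (hB U) (abs_nonneg _)
  have hcw : ∀ U : GaugeConfig 4 N SU3, ENNReal.ofReal (Real.exp (-(|β| * B))) ≤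
      ENNReal.ofReal (Real.exp (-(β * wilsonAction (fundamentalRep (Fin 3)) U))) := fun U =>
    ENNReal.ofReal_le_ofReal (Real.exp_le_exp.2 (by have := (abs_le.1 (hbd U)).2; linarith))
  have hwC : ∀ U : GaugeConfig 4 N SU3,
      ENNReal.ofReal (Real.exp (-(β * wilsonAction (fundamentalRep (Fin 3)) U))) ≤
        ENNReal.ofReal (Real.exp (|β| * B)) := fun U =>
    ENNReal.ofReal_le_ofReal (Real.exp_le_exp.2 (by have := (abs_le.1 (hbd U)).1; linarith))
  have hc : ENNReal.ofReal (Real.exp (-(|β| * B))) ≠ 0 :=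
    (ENNReal.ofReal_pos.2 (Real.exp_pos _)).ne'
  -- `μ_W = Z⁻¹ • π.withDensity w`
  have hμ : wilsonMeasure (d := 4) (L := N) (fundamentalRep (Fin 3)) β =
      (partitionFunction (d := 4) (L := N) (fundamentalRep (Fin 3)) β)⁻¹ •
        (Measure.pi fun _ : Edge 4 N => haarProbability SU3).withDensity fun U =>
          ENNReal.ofReal (Real.exp (-(β * wilsonAction (fundamentalRep (Fin 3)) U))) := by
    simp only [wilsonMeasure, wilsonWeight, neg_mul]
  have hfin : ∀ᵐ U ∂(Measure.pi fun _ : Edge 4 N => haarProbability SU3),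
      ENNReal.ofReal (Real.exp (-(β * wilsonAction (fundamentalRep (Fin 3)) U))) < ∞ :=
    Eventually.of_forall fun _ => ENNReal.ofReal_lt_top
  rw [hμ, lintegral_smul_measure, lintegral_smul_measure,
    lintegral_withDensity_eq_lintegral_mul_non_measurable _ hwm hfin,
    lintegral_withDensity_eq_lintegral_mul_non_measurable _ hwm hfin]
  simp only [Pi.mul_apply]
  congr 1
  exact pi_lintegral_mul_eq_lintegral_mul_resample (haarProbability SU3) P hΦ hwm hc
    ENNReal.ofReal_ne_top hcw hwC

end Summit.QuantumFields.QCD.Theorems.AdjugateAnticoncentrationPin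

end
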